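import Literature.NumberTheory.Transcendental.CurvePeriodsTransportProofs
import Literature.NumberTheory.Transcendental.CurvePeriodsGmLoopsProofs
import Mathlib.Analysis.Calculus.InverseFunctionTheorem.Deriv
import Mathlib.Analysis.SpecialFunctions.Complex.Log
import Mathlib.Analysis.SpecialFunctions.Pow.Deriv
import HarnessLib

/-!
# Periods of curve type: the de Rham side in genus one (forms on `y² = x³ + Ax + B`)

Companion of `Literature/NumberTheory/Transcendental/CurvePeriods.lean` (Huber–Wüstholz 2022,
Thm. 13.3 (2), rendered on explicit period symbols `(Z, ω, γ)` with the elementary relations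
(R1)–(R5); the general statement is the named fact `HuberWustholzCurvePeriods`). After the
genus-zero case (`CurvePeriodsGenusZeroProofs.lean`, from Baker's theorem) the next periods of
curve type are those of elliptic curves: `ω₁, ω₂` (first kind), the quasi-periods `η₁, η₂`
(second kind) and incomplete elliptic integrals between algebraic points (book §13.2, Thm. 13.9;
Ch. 15). Their transcendence theory (Schneider, Masser, Wüstholz's analytic subgroup theorem) is
mostly not available in the tree; this file provides the **transcendence-free de Rham half** of
the genus-one case, entirely inside the relation module:

* `weierCurve A B` — the affine Weierstrass curve `E_{A,B} : y² = x³ + Ax + B` (the elliptic curve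
  minus `O`), a smooth affine curve over `ℚ̄` for algebraic `A, B` with `4A³ + 27B² ≠ 0`
  (`Weier.isSmoothAffineCurve`; the Bézout identity
  `(6Ax² − 9Bx + 4A²) f′ − (18Ax − 27B) f = 4A³ + 27B²`, `Weier.bezout`, gives both the Jacobian
  criterion and the representative below; non-isolatedness via a local square root of `f`, resp.
  the holomorphic local inverse of `f` at the `2`-torsion points);
* `Weier.theta0` — the POLYNOMIAL representative `θ₀ = (1/D)(−U y dx + 2V dy)` of the invariant
  differential `dx/y` (`y · θ₀ = dx` on tangent vectors, `Weier.z_one_mul_theta0_apply`), and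
  `xθ₀` for `x dx/y`;
* `Weier.exists_reduction` — **every polynomial 1-form over `ℚ̄` on `E_{A,B}` is
  `a · θ₀ + b · xθ₀ + dP + ν`** with `a, b ∈ ℚ̄`, `P ∈ ℚ̄[x, y]`, `ν` over `ℚ̄` vanishing on the
  tangent lines (i.e. `H¹_dR(E_{A,B}) = ℚ̄ · [dx/y] ⊕ ℚ̄ · [x dx/y]`, effectively): the rules
  `p y dx ≡ (pf) θ₀`, `q dy ≡ (q f′/2) θ₀`, `q y dy ≡ (q f′/2) dx` (`vanishesOn_rule_a/b/c`), the
  splitting `G = g₀(x) + g₁(x) y` on the curve (`exists_split`), exactness of `p(x) dx`, and the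
  classical degree reduction `d(xᵐ y) ≡ (m x^{m−1} f + xᵐ f′/2) dx/y` (`rPoly_smul_theta0`,
  `ered_X_pow_smul_theta0`);
* `Weier.exists_rel_symbol` — consequently every period symbol on `E_{A,B}` is
  `a · (E, θ₀, γ) + b · (E, xθ₀, γ) + e · 𝟙` modulo (R1)–(R3), `a, b, e ∈ ℚ̄`.

What is NOT here (the analytic and the arithmetic halves of the genus-one case): the reduction of
arbitrary `C¹` paths on `E(ℂ)` to standard ones through the uniformisation `(℘, ℘′)` (relations
(R5)), and the transcendence input (Schneider's theorem is proved in the tree, `schneider_holds`;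
Masser's and Wüstholz's linear independence results are not).

## References

* A. Huber, G. Wüstholz, *Transcendence and Linear Relations of 1-Periods*, Cambridge Tracts in
  Mathematics 227, CUP 2022 [HuberWustholz2022]: §13.2, Thm. 13.9 (pp. 122–125 of the held
  text), Ch. 15 (dimension computations for elliptic curves), Thm. 13.3 (2) (p. 121).
-/

noncomputable section

open scoped BigOperators Topology
open MvPolynomial Set Complex Filter

namespace Literature.NumberTheory.Transcendental

namespace CurvePeriods

set_option quotPrecheck false in
/-- Membership in the `ℚ̄`-span of the elementary relations, in the format of the conclusion of
`HuberWustholzCurvePeriods`. -/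
local notation "InSpan" c:max => ∃ (k : ℕ) (ρ : Fin k → (PeriodSymbol →₀ ℂ)) (a : Fin k → ℂ),
  (∀ l, IsElementaryRelation (ρ l)) ∧ (∀ l, IsAlgebraic ℚ (a l)) ∧ c = ∑ l, a l • ρ l

/-! ### The affine Weierstrass curves `E_{A,B} : y² = x³ + Ax + B` -/

namespace Weier

variable (A B : ℂ)

/-- `f = x³ + Ax + B ∈ ℂ[x, y]`. [folklore] -/
def fPoly : MvPolynomial (Fin 2) ℂ := X 0 ^ 3 + C A * X 0 + C B

/-- `U = 18Ax − 27B`. [folklore] -/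
def uPol : MvPolynomial (Fin 2) ℂ := C (18 * A) * X 0 - C (27 * B)

/-- `V = 6Ax² − 9Bx + 4A²`. [folklore] -/
def vPol : MvPolynomial (Fin 2) ℂ := C (6 * A) * X 0 ^ 2 - C (9 * B) * X 0 + C (4 * A ^ 2)

/-- The discriminant quantity `D = 4A³ + 27B²` (`Δ = −16 D`). [folklore] -/
def disc : ℂ := 4 * A ^ 3 + 27 * B ^ 2

/-- [folklore] -/
theorem pderiv_zero_fPoly : pderiv 0 (fPoly A B) = C 3 * X 0 ^ 2 + C A := by
  simp only [fPoly, map_add, Derivation.leibniz_pow, Derivation.leibniz, pderiv_C, pderiv_X_self,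
    add_zero, mul_one, smul_eq_mul, nsmul_eq_mul, map_ofNat]
  ring

/-- [folklore] -/
theorem pderiv_one_fPoly : pderiv 1 (fPoly A B) = 0 := by
  simp [fPoly, Derivation.leibniz_pow, Derivation.leibniz, pderiv_X_of_ne (show (0 : Fin 2) ≠ 1 by decide)]

/-- **The Bézout identity** `V f′ − U f = D` for `f = x³ + Ax + B`:
`(6Ax² − 9Bx + 4A²)(3x² + A) − (18Ax − 27B)(x³ + Ax + B) = 4A³ + 27B²`. [folklore] -/
theorem bezout : vPol A B * pderiv 0 (fPoly A B) - uPol A B * fPoly A B = C (disc A B) := by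
  rw [pderiv_zero_fPoly]
  simp only [fPoly, uPol, vPol, disc, map_mul, map_add, map_pow, map_ofNat]
  ring

/-- [folklore] -/
theorem eval_fPoly (z : Fin 2 → ℂ) : eval z (fPoly A B) = z 0 ^ 3 + A * z 0 + B := by
  simp [fPoly]

/-- [folklore] -/
theorem eval_pderiv_zero_fPoly (z : Fin 2 → ℂ) : eval z (pderiv 0 (fPoly A B)) = 3 * z 0 ^ 2 + A := by
  rw [pderiv_zero_fPoly]
  simp

/-- The Bézout identity at a point. [folklore] -/
theorem eval_bezout (z : Fin 2 → ℂ) :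
    eval z (vPol A B) * eval z (pderiv 0 (fPoly A B)) - eval z (uPol A B) * eval z (fPoly A B) =
      disc A B := by
  have h := congrArg (eval z) (bezout A B)
  simpa only [map_sub, map_mul, eval_C] using h

section HasAlgCoeffs

variable (hA : IsAlgebraic ℚ A) (hB : IsAlgebraic ℚ B)
include hA hB

/-- [folklore] -/
theorem hasAlgCoeffs_fPoly : HasAlgCoeffs (fPoly A B) :=
  (((hasAlgCoeffs_X 0).pow 3).add ((hasAlgCoeffs_C hA).mul (hasAlgCoeffs_X 0))).add (hasAlgCoeffs_C hB)

/-- [folklore] -/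
theorem hasAlgCoeffs_uPol : HasAlgCoeffs (uPol A B) :=
  ((hasAlgCoeffs_C ((isAlgebraic_nat 18).mul hA)).mul (hasAlgCoeffs_X 0)).sub
    (hasAlgCoeffs_C ((isAlgebraic_nat 27).mul hB))

/-- [folklore] -/
theorem hasAlgCoeffs_vPol : HasAlgCoeffs (vPol A B) :=
  (((hasAlgCoeffs_C ((isAlgebraic_nat 6).mul hA)).mul ((hasAlgCoeffs_X 0).pow 2)).sub
    ((hasAlgCoeffs_C ((isAlgebraic_nat 9).mul hB)).mul (hasAlgCoeffs_X 0))).add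
    (hasAlgCoeffs_C ((isAlgebraic_nat 4).mul (hA.pow 2)))

/-- [folklore] -/
theorem isAlgebraic_disc : IsAlgebraic ℚ (disc A B) :=
  ((isAlgebraic_nat 4).mul (hA.pow 3)).add ((isAlgebraic_nat 27).mul (hB.pow 2))

end HasAlgCoeffs

end Weier

/-- **The affine Weierstrass curve** `E_{A,B} = {y² = x³ + Ax + B} ⊂ 𝔸²` (the elliptic curve
minus its point at infinity, for `4A³ + 27B² ≠ 0`). Reducible, so that `Fin (weierCurve A B).n` is
`Fin 2`. [cite: HuberWustholz2022, §13.2 (p. 123)] -/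
abbrev weierCurve (A B : ℂ) : CurveData := ⟨2, 1, ![X 1 ^ 2 - Weier.fPoly A B]⟩

namespace Weier

variable (A B : ℂ)

/-- `z ∈ E_{A,B} ↔ z₁² = f(z₀)`. [folklore] -/
theorem mem_points_iff (z : Fin 2 → ℂ) :
    z ∈ (weierCurve A B).points ↔ z 1 ^ 2 = eval z (fPoly A B) := by
  refine (CurveData.mem_points (Z := weierCurve A B) (z := z)).trans ?_
  simp [sub_eq_zero]

/-- The gradient of `y² − f`: `(−f′(x), 2y)`. [folklore] -/
theorem gradient_eq (z : Fin 2 → ℂ) :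
    (weierCurve A B).gradient 0 z = ![-(eval z (pderiv 0 (fPoly A B))), 2 * z 1] := by
  funext k
  simp only [CurveData.gradient, Matrix.cons_val_zero]
  fin_cases k
  · simp [Derivation.leibniz_pow, pderiv_X_of_ne (show (1 : Fin 2) ≠ 0 by decide)]
  · simp [Derivation.leibniz_pow, pderiv_one_fPoly]

/-- The tangent line at `z`: `−f′(z₀) v₀ + 2 z₁ v₁ = 0`. [folklore] -/
theorem mem_tangentSpace_iff (z v : Fin 2 → ℂ) :
    v ∈ (weierCurve A B).tangentSpace z ↔
      -(eval z (pderiv 0 (fPoly A B))) * v 0 + 2 * z 1 * v 1 = 0 := by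
  simp only [CurveData.tangentSpace, mem_setOf_eq, Fin.forall_fin_one, Fin.sum_univ_two]
  rw [show (0 : Fin (weierCurve A B).m) = (0 : Fin 1) from rfl, gradient_eq]
  simp

/-- The equation of `E_{A,B}` is over `ℚ̄`. [folklore] -/
theorem hasAlgCoeffs_F (hA : IsAlgebraic ℚ A) (hB : IsAlgebraic ℚ B) :
    ∀ j, HasAlgCoeffs ((weierCurve A B).F j) := by
  intro j
  fin_cases j
  simpa using ((hasAlgCoeffs_X (n := 2) 1).pow 2).sub (hasAlgCoeffs_fPoly A B hA hB)

/-- **`E_{A,B}` is a smooth affine curve over `ℚ̄`** for algebraic `A, B` with `4A³ + 27B² ≠ 0`: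
the gradient `(−f′, 2y)` cannot vanish on the curve (at such a point `f = f′ = 0`, contradicting
the Bézout identity `V f′ − U f = 4A³ + 27B²`), and no point is isolated (a local square root of
`f(x₀ + u)` at points with `y₀ ≠ 0`, the holomorphic local inverse of `f` at the `2`-torsion points
`y₀ = 0`). [cite: HuberWustholz2022, §13.2 (p. 123)] -/
theorem isSmoothAffineCurve (hA : IsAlgebraic ℚ A) (hB : IsAlgebraic ℚ B) (hD : disc A B ≠ 0) :
    (weierCurve A B).IsSmoothAffineCurve where
  algebraic := hasAlgCoeffs_F A B hA hB
  rank_eq z hz := by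
    rw [mem_points_iff] at hz
    have hrange : (Set.range fun j : Fin 1 => (weierCurve A B).gradient j z) =
        {(weierCurve A B).gradient 0 z} := by
      rw [Set.range_unique]
      rfl
    rw [hrange, gradient_eq]
    have hv : (![-(eval z (pderiv 0 (fPoly A B))), 2 * z 1] : Fin 2 → ℂ) ≠ 0 := by
      intro h
      have h0 := congrFun h 0
      have h1 := congrFun h 1
      simp only [Matrix.cons_val_zero, Matrix.cons_val_one, Pi.zero_apply, neg_eq_zero,
        mul_eq_zero, OfNat.ofNat_ne_zero, false_or] at h0 h1
      have hf : eval z (fPoly A B) = 0 := by rw [← hz, h1]; ring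
      have hb := eval_bezout A B z
      rw [h0, hf, mul_zero, mul_zero, sub_zero] at hb
      exact hD hb.symm
    exact finrank_span_singleton hv
  not_isolated z hz := by
    rw [mem_points_iff, eval_fPoly] at hz
    -- the cubic as a function, with its derivative
    obtain ⟨g, hg⟩ : ∃ g : ℂ → ℂ, g = fun x => x ^ 3 + A * x + B := ⟨_, rfl⟩
    have hgd : ∀ x, HasStrictDerivAt g (3 * x ^ 2 + A) x := fun x => by
      rw [hg]
      have h := ((hasStrictDerivAt_pow 3 x).add ((hasStrictDerivAt_id x).const_mul A)).add_const B
      simpa using h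
    have hgc : Continuous g := by rw [hg]; fun_prop
    have hgz : g (z 0) = z 1 ^ 2 := by rw [hg]; exact hz.symm
    by_cases hy : z 1 = 0
    · -- a `2`-torsion point: parametrise by `y` via the local inverse of `f` at `x₀`
      have hf0 : g (z 0) = 0 := by rw [hgz, hy]; ring
      have hf'0 : 3 * z 0 ^ 2 + A ≠ 0 := by
        intro h
        have hb := eval_bezout A B z
        rw [eval_pderiv_zero_fPoly, eval_fPoly, h, mul_zero, zero_sub] at hb
        have : z 0 ^ 3 + A * z 0 + B = 0 := by rw [← hz, hy]; ring
        rw [this, mul_zero, neg_zero] at hb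
        exact hD hb.symm
      have hF := (hgd (z 0)).hasStrictFDerivAt_equiv hf'0
      set ψ := hF.localInverse g _ (z 0) with hψ
      have hψc : ContinuousAt ψ 0 := by
        have h := hF.localInverse_continuousAt
        rwa [hf0] at h
      have hψ0 : ψ 0 = z 0 := by
        have h := hF.localInverse_apply_image
        rwa [hf0] at h
      have hright : ∀ᶠ w in 𝓝 (0 : ℂ), g (ψ w) = w := by
        have h := hF.eventually_right_inverse
        rwa [hf0] at h
      -- the curve `v ↦ (ψ(v²), v)`
      obtain ⟨c, hc⟩ : ∃ c : ℝ → (Fin 2 → ℂ), c = fun v : ℝ => ![ψ ((v : ℂ) ^ 2), (v : ℂ)] :=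
        ⟨_, rfl⟩
      have hsq : Tendsto (fun v : ℝ => (v : ℂ) ^ 2) (𝓝 0) (𝓝 0) := by
        have h : Continuous fun v : ℝ => (v : ℂ) ^ 2 := by fun_prop
        simpa using h.tendsto 0
      have hcc : Tendsto c (𝓝 0) (𝓝 z) := by
        rw [hc, tendsto_pi_nhds]
        intro k
        fin_cases k
        · have h := hψc.tendsto.comp hsq
          rw [hψ0] at h
          simpa [Function.comp_def] using h
        · have h : Continuous fun v : ℝ => (v : ℂ) := by fun_prop
          simpa [hy] using h.tendsto 0
      refine mem_closure_of_tendsto (b := 𝓝[≠] (0 : ℝ)) (f := c)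
        (hcc.mono_left nhdsWithin_le_nhds) ?_
      have h1 : ∀ᶠ v : ℝ in 𝓝[≠] 0, g (ψ ((v : ℂ) ^ 2)) = (v : ℂ) ^ 2 :=
        (hsq.eventually hright).filter_mono nhdsWithin_le_nhds
      have h2 : ∀ᶠ v : ℝ in 𝓝[≠] 0, v ≠ 0 := eventually_nhdsWithin_of_forall fun v hv => hv
      filter_upwards [h1, h2] with v hv1 hv2
      refine ⟨(mem_points_iff A B _).2 ?_, ?_⟩
      · rw [eval_fPoly, hc]
        simp only [Matrix.cons_val_one, Matrix.cons_val_zero]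
        have h := hv1
        simp only [hg] at h
        simpa using h.symm
      · intro h
        have h1' : c v 1 = z 1 := congrFun h 1
        simp [hc, hy] at h1'
        exact hv2 h1'
    · -- `y₀ ≠ 0`: a local square root of `f(x₀ + u)`
      have hy2 : z 1 ^ 2 ≠ 0 := pow_ne_zero 2 hy
      obtain ⟨w, hw⟩ : ∃ w : ℝ → ℂ, w = fun u : ℝ => g (z 0 + (u : ℂ)) / z 1 ^ 2 := ⟨_, rfl⟩
      have hwc : Continuous w := by
        rw [hw]
        exact (hgc.comp (by fun_prop)).div_const _
      have hw0 : w 0 = 1 := by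
        rw [hw]
        simp only [ofReal_zero, add_zero]
        rw [hgz, div_self hy2]
      obtain ⟨Y, hY⟩ : ∃ Y : ℝ → ℂ, Y = fun u : ℝ => z 1 * exp (log (w u) / 2) := ⟨_, rfl⟩
      have hYc : ContinuousAt Y 0 := by
        rw [hY]
        refine continuousAt_const.mul (ContinuousAt.cexp (ContinuousAt.div_const ?_ _))
        exact hwc.continuousAt.clog (by rw [hw0]; exact one_mem_slitPlane)
      have hY0 : Y 0 = z 1 := by rw [hY]; simp [hw0]
      have hYsq : ∀ u, w u ≠ 0 → Y u ^ 2 = g (z 0 + (u : ℂ)) := fun u hu => by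
        rw [hY]
        simp only
        rw [mul_pow, ← exp_nat_mul, show ((2 : ℕ) : ℂ) * (log (w u) / 2) = log (w u) by push_cast; ring,
          exp_log hu, hw]
        simp only
        field_simp
      obtain ⟨c, hc⟩ : ∃ c : ℝ → (Fin 2 → ℂ), c = fun u : ℝ => ![z 0 + (u : ℂ), Y u] := ⟨_, rfl⟩
      have hcc : Tendsto c (𝓝 0) (𝓝 z) := by
        rw [hc, tendsto_pi_nhds]
        intro k
        fin_cases k
        · have h : Continuous fun u : ℝ => z 0 + (u : ℂ) := by fun_prop
          simpa using h.tendsto 0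
        · have h := hYc.tendsto
          rw [hY0] at h
          simpa using h
      refine mem_closure_of_tendsto (b := 𝓝[≠] (0 : ℝ)) (f := c)
        (hcc.mono_left nhdsWithin_le_nhds) ?_
      have h1 : ∀ᶠ u : ℝ in 𝓝[≠] 0, w u ≠ 0 :=
        (hwc.continuousAt.eventually_ne (by rw [hw0]; exact one_ne_zero)).filter_mono
          nhdsWithin_le_nhds
      have h2 : ∀ᶠ u : ℝ in 𝓝[≠] 0, u ≠ 0 := eventually_nhdsWithin_of_forall fun u hu => hu
      filter_upwards [h1, h2] with u hu1 hu2
      refine ⟨(mem_points_iff A B _).2 ?_, ?_⟩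
      · rw [eval_fPoly, hc]
        simp only [Matrix.cons_val_one, Matrix.cons_val_zero]
        rw [hYsq u hu1]
        simp only [hg]
      · intro h
        have h0 := congrFun h 0
        simp only [hc, Matrix.cons_val_zero, add_eq_left, ofReal_eq_zero] at h0
        exact hu2 h0

/-! ### The invariant differential `θ₀ = dx/y` as a polynomial form, and the basic congruences -/

/-- **The polynomial representative of `dx/y`**: `θ₀ = (1/D)(−U y dx + 2V dy)`. On `E_{A,B}`,
`−U y dx + 2V dy = (−U y² + V f′)/y dx = (V f′ − U f)/y dx = D dx/y` by the Bézout identity.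
[folklore] -/
def theta0 : Fin 2 → MvPolynomial (Fin 2) ℂ :=
  ![C (-(1 / disc A B)) * uPol A B * X 1, C (2 / disc A B) * vPol A B]

section HasAlgCoeffs

variable (hA : IsAlgebraic ℚ A) (hB : IsAlgebraic ℚ B)
include hA hB

/-- [folklore] -/
theorem hasAlgCoeffs_theta0 : ∀ k, HasAlgCoeffs (theta0 A B k) := by
  have hD := isAlgebraic_disc A B hA hB
  intro k
  fin_cases k
  · have hc : IsAlgebraic ℚ (-(1 / disc A B)) := by rw [one_div]; exact hD.inv.neg
    simpa [theta0] using ((hasAlgCoeffs_C hc).mul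
      (hasAlgCoeffs_uPol A B hA hB)).mul (hasAlgCoeffs_X (n := 2) 1)
  · simpa [theta0] using (hasAlgCoeffs_C (by
      rw [div_eq_mul_inv]; exact (isAlgebraic_nat 2).mul hD.inv)).mul (hasAlgCoeffs_vPol A B hA hB)

/-- [folklore] -/
theorem hasAlgCoeffs_smul_theta0 {R : MvPolynomial (Fin 2) ℂ} (hR : HasAlgCoeffs R) :
    ∀ k, HasAlgCoeffs ((R • theta0 A B) k) := fun k => by
  rw [Pi.smul_apply, smul_eq_mul]
  exact hR.mul (hasAlgCoeffs_theta0 A B hA hB k)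

end HasAlgCoeffs

/-- **`y · θ₀ = dx` on tangent vectors** (`θ₀` is `dx/y`): for `z ∈ E_{A,B}` and `v` tangent at `z`,
`z₁ · θ₀(z)(v) = v₀`. [folklore] -/
theorem z_one_mul_theta0_apply {z v : Fin 2 → ℂ} (hz : z ∈ (weierCurve A B).points)
    (hv : v ∈ (weierCurve A B).tangentSpace z) (hD : disc A B ≠ 0) :
    z 1 * (∑ k, eval z (theta0 A B k) * v k) = v 0 := by
  have hc := (mem_points_iff A B z).1 hz
  rw [mem_tangentSpace_iff] at hv
  have hb := eval_bezout A B z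
  simp only [theta0, Fin.sum_univ_two, Matrix.cons_val_zero, Matrix.cons_val_one, map_mul, eval_C,
    eval_X]
  field_simp
  linear_combination (eval z (vPol A B)) * hv + (-(eval z (uPol A B) * v 0)) * hc + v 0 * hb

variable {A B} in
/-- A form whose two coefficients vanish at the points of `E_{A,B}` vanishes on `E_{A,B}`.
[folklore] -/
theorem vanishesOn_of_eval_eq_zero (ν : Fin 2 → MvPolynomial (Fin 2) ℂ)
    (h : ∀ z ∈ (weierCurve A B).points, ∀ k, eval z (ν k) = 0) : VanishesOn (weierCurve A B) ν := by
  intro z hz v _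
  simp [h z hz]

/-- **Rule (a): `p y dx ≡ (p f) θ₀`** modulo a form vanishing on `E_{A,B}` (`y dx = y² dx/y = f dx/y`).
[folklore] -/
theorem vanishesOn_rule_a (hD : disc A B ≠ 0) (p : MvPolynomial (Fin 2) ℂ) :
    VanishesOn (weierCurve A B)
      ((![p * X 1, 0] : Fin 2 → MvPolynomial (Fin 2) ℂ) - (p * fPoly A B) • theta0 A B) := by
  intro z hz v hv
  have hc := (mem_points_iff A B z).1 hz
  rw [mem_tangentSpace_iff] at hv
  have hb := eval_bezout A B z
  simp only [theta0, Fin.sum_univ_two, Pi.sub_apply, Pi.smul_apply, smul_eq_mul, Matrix.cons_val_zero,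
    Matrix.cons_val_one, map_sub, map_mul, map_zero, eval_X, eval_C]
  field_simp
  linear_combination (-(eval z p * eval z (vPol A B) * z 1)) * hv +
    (2 * eval z p * eval z (vPol A B) * v 1) * hc + (-(eval z p * z 1 * v 0)) * hb

/-- **Rule (b): `q dy ≡ (q f′/2) θ₀`** modulo a form vanishing on `E_{A,B}` (`dy = (f′/2y) dx`).
[folklore] -/
theorem vanishesOn_rule_b (hD : disc A B ≠ 0) (q : MvPolynomial (Fin 2) ℂ) :
    VanishesOn (weierCurve A B)
      ((![0, q] : Fin 2 → MvPolynomial (Fin 2) ℂ) -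
        (q * (C (1 / 2) * pderiv 0 (fPoly A B))) • theta0 A B) := by
  intro z hz v hv
  have hc := (mem_points_iff A B z).1 hz
  rw [mem_tangentSpace_iff] at hv
  have hb := eval_bezout A B z
  simp only [Pi.sub_apply, Pi.smul_apply, smul_eq_mul, Matrix.cons_val_zero, Matrix.cons_val_one,
    map_sub, map_mul, map_zero, eval_X, eval_C, theta0, Fin.sum_univ_two]
  field_simp
  linear_combination (-(eval z q * eval z (uPol A B) * z 1)) * hv +
    (2 * eval z q * eval z (uPol A B) * v 1) * hc + (-(2 * eval z q * v 1)) * hb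

/-- **Rule (c): `q y dy ≡ (q f′/2) dx`** (exactly `(q/2) · d(y² − f)`). [folklore] -/
theorem vanishesOn_rule_c (q : MvPolynomial (Fin 2) ℂ) :
    VanishesOn (weierCurve A B)
      ((![0, q * X 1] : Fin 2 → MvPolynomial (Fin 2) ℂ) -
        ![q * (C (1 / 2) * pderiv 0 (fPoly A B)), 0]) := by
  intro z hz v hv
  rw [mem_tangentSpace_iff] at hv
  simp only [Pi.sub_apply, Matrix.cons_val_zero, Matrix.cons_val_one, map_sub, map_mul, map_zero,
    eval_X, eval_C, Fin.sum_univ_two]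
  linear_combination (eval z q / 2) * hv

/-! ### Reducible forms: `ω = a θ₀ + b xθ₀ + dP + ν` on `E_{A,B}` -/

set_option quotPrecheck false in
/-- `ω = a · θ₀ + b · xθ₀ + dP + ν` on `E_{A,B}` with `a, b ∈ ℚ̄`, `P ∈ ℚ̄[x, y]`, `ν` over `ℚ̄`
vanishing on `E_{A,B}` (`θ₀ = dx/y`, `xθ₀ = x dx/y`: the standard basis of `H¹_dR(E)`). -/
local notation "ERed" A:max B:max ω:max => ∃ (a b : ℂ) (P : MvPolynomial (Fin 2) ℂ)
  (ν : Fin 2 → MvPolynomial (Fin 2) ℂ), IsAlgebraic ℚ a ∧ IsAlgebraic ℚ b ∧ HasAlgCoeffs P ∧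
    (∀ k, HasAlgCoeffs (ν k)) ∧ VanishesOn (weierCurve A B) ν ∧
    ω = a • theta0 A B + b • ((X 0 : MvPolynomial (Fin 2) ℂ) • theta0 A B) + formD P + ν

/-- [folklore] -/
theorem hasAlgCoeffs_zero_form : ∀ k, HasAlgCoeffs ((0 : Fin 2 → MvPolynomial (Fin 2) ℂ) k) :=
  fun _ => hasAlgCoeffs_zero

variable {A B}

/-- Exact forms are reducible. [folklore] -/
theorem ered_formD {P : MvPolynomial (Fin 2) ℂ} (hP : HasAlgCoeffs P) : ERed A B (formD P) :=
  ⟨0, 0, P, 0, isAlgebraic_zero, isAlgebraic_zero, hP, hasAlgCoeffs_zero_form, VanishesOn.zero _,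
    by simp⟩

/-- Vanishing forms are reducible. [folklore] -/
theorem ered_vanish {ν : Fin 2 → MvPolynomial (Fin 2) ℂ} (hν : ∀ k, HasAlgCoeffs (ν k))
    (hv : VanishesOn (weierCurve A B) ν) : ERed A B ν :=
  ⟨0, 0, 0, ν, isAlgebraic_zero, isAlgebraic_zero, hasAlgCoeffs_zero, hν, hv,
    by rw [formD_zero]; simp⟩

/-- `θ₀` is reducible. [folklore] -/
theorem ered_theta0 : ERed A B (theta0 A B) :=
  ⟨1, 0, 0, 0, isAlgebraic_one, isAlgebraic_zero, hasAlgCoeffs_zero, hasAlgCoeffs_zero_form,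
    VanishesOn.zero _, by rw [formD_zero]; simp⟩

/-- `xθ₀` is reducible. [folklore] -/
theorem ered_X_theta0 : ERed A B ((X 0 : MvPolynomial (Fin 2) ℂ) • theta0 A B) :=
  ⟨0, 1, 0, 0, isAlgebraic_zero, isAlgebraic_one, hasAlgCoeffs_zero, hasAlgCoeffs_zero_form,
    VanishesOn.zero _, by rw [formD_zero]; simp⟩

/-- Reducible forms are stable under sums. [folklore] -/
theorem ered_add {ω₁ ω₂ : Fin 2 → MvPolynomial (Fin 2) ℂ} (h₁ : ERed A B ω₁) (h₂ : ERed A B ω₂) :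
    ERed A B (ω₁ + ω₂) := by
  obtain ⟨a₁, b₁, P₁, ν₁, ha₁, hb₁, hP₁, hν₁, hv₁, he₁⟩ := h₁
  obtain ⟨a₂, b₂, P₂, ν₂, ha₂, hb₂, hP₂, hν₂, hv₂, he₂⟩ := h₂
  refine ⟨a₁ + a₂, b₁ + b₂, P₁ + P₂, ν₁ + ν₂, ha₁.add ha₂, hb₁.add hb₂, hP₁.add hP₂,
    fun k => (hν₁ k).add (hν₂ k), hv₁.add hv₂, ?_⟩
  rw [he₁, he₂, formD_add, add_smul, add_smul]
  abel

/-- Reducible forms are stable under algebraic scalars. [folklore] -/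
theorem ered_smul {ω : Fin 2 → MvPolynomial (Fin 2) ℂ} {c : ℂ} (hc : IsAlgebraic ℚ c)
    (h : ERed A B ω) : ERed A B (c • ω) := by
  obtain ⟨a, b, P, ν, ha, hb, hP, hν, hv, he⟩ := h
  refine ⟨c * a, c * b, C c * P, c • ν, hc.mul ha, hc.mul hb, (hasAlgCoeffs_C hc).mul hP,
    fun k => (hν k).smul hc, hv.smul c, ?_⟩
  rw [he, formD_C_mul, smul_add, smul_add, smul_add, smul_smul, smul_smul]

/-- Reducibility only depends on the form on `E_{A,B}`. [folklore] -/
theorem ered_congr {ω ω' : Fin 2 → MvPolynomial (Fin 2) ℂ} (hω : ∀ k, HasAlgCoeffs (ω k))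
    (hω' : ∀ k, HasAlgCoeffs (ω' k)) (hd : VanishesOn (weierCurve A B) (ω - ω')) (h : ERed A B ω') :
    ERed A B ω := by
  obtain ⟨a, b, P, ν, ha, hb, hP, hν, hv, he⟩ := h
  refine ⟨a, b, P, ν + (ω - ω'), ha, hb, hP, fun k => (hν k).add ((hω k).sub (hω' k)), hv.add hd, ?_⟩
  rw [← add_assoc, ← he]
  abel

/-- Reducible forms are stable under finite sums. [folklore] -/
theorem ered_sum {ι : Type*} (S : Finset ι) (ω : ι → Fin 2 → MvPolynomial (Fin 2) ℂ)
    (h : ∀ i ∈ S, ERed A B (ω i)) : ERed A B (∑ i ∈ S, ω i) := by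
  classical
  induction S using Finset.induction_on with
  | empty =>
    rw [Finset.sum_empty]
    exact ered_vanish hasAlgCoeffs_zero_form (VanishesOn.zero _)
  | insert j S hj ih =>
    rw [Finset.sum_insert hj]
    exact ered_add (h j (Finset.mem_insert_self j S)) (ih fun i hi => h i (Finset.mem_insert_of_mem hi))

variable (A B)

/-! ### Linearity of `R ↦ R θ₀` -/

/-- [folklore] -/
theorem C_mul_smul_theta0 (c : ℂ) (R : MvPolynomial (Fin 2) ℂ) :
    (C c * R) • theta0 A B = c • (R • theta0 A B) := by
  funext k
  simp only [Pi.smul_apply, smul_eq_mul, smul_eq_C_mul, mul_assoc]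

/-- [folklore] -/
theorem C_smul_theta0 (c : ℂ) : (C c : MvPolynomial (Fin 2) ℂ) • theta0 A B = c • theta0 A B := by
  funext k
  simp only [Pi.smul_apply, smul_eq_mul, smul_eq_C_mul]

/-! ### The degree reduction `d(xᵐ y) ≡ (m x^{m−1} f + xᵐ f′/2) θ₀` -/

/-- `d(xᵐ y) = m x^{m−1} y dx + xᵐ dy`. [folklore] -/
theorem formD_X_pow_mul_X_one (m : ℕ) :
    formD (X 0 ^ m * X 1 : MvPolynomial (Fin 2) ℂ) =
      ![(m : MvPolynomial (Fin 2) ℂ) * X 0 ^ (m - 1) * X 1, X 0 ^ m] := by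
  funext k
  fin_cases k
  · simp [formD, Derivation.leibniz, Derivation.leibniz_pow,
      pderiv_X_of_ne (show (1 : Fin 2) ≠ 0 by decide)]
    ring
  · simp [formD, Derivation.leibniz, Derivation.leibniz_pow,
      pderiv_X_of_ne (show (0 : Fin 2) ≠ 1 by decide)]

/-- The polynomial `R_m = m x^{m−1} f + xᵐ f′/2`. [folklore] -/
theorem rPoly_eq (m : ℕ) :
    ((m : MvPolynomial (Fin 2) ℂ) * X 0 ^ (m - 1) * fPoly A B +
        X 0 ^ m * (C (1 / 2) * pderiv 0 (fPoly A B)) : MvPolynomial (Fin 2) ℂ) =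
      C ((m : ℂ) + 3 / 2) * X 0 ^ (m + 2) + C (((m : ℂ) + 1 / 2) * A) * X 0 ^ m +
        C ((m : ℂ) * B) * X 0 ^ (m - 1) := by
  rw [pderiv_zero_fPoly, show ((m : ℂ) + 3 / 2) = m + 3 * (1 / 2) by ring]
  simp only [map_add, map_mul, map_natCast, map_ofNat, fPoly]
  rcases m with _ | k
  · simp only [Nat.cast_zero, Nat.zero_sub, pow_zero, zero_add, zero_mul, mul_one, one_mul, add_zero]
    ring
  · simp only [Nat.cast_succ, Nat.add_sub_cancel]
    ring

/-- **Degree reduction**: `R_m θ₀ = d(xᵐ y) + ν` with `ν` vanishing on `E_{A,B}` (rules (a), (b)).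
[folklore] -/
theorem rPoly_smul_theta0 (hD : disc A B ≠ 0) (m : ℕ) :
    ∃ ν : Fin 2 → MvPolynomial (Fin 2) ℂ, VanishesOn (weierCurve A B) ν ∧
      ((m : MvPolynomial (Fin 2) ℂ) * X 0 ^ (m - 1) * fPoly A B +
          X 0 ^ m * (C (1 / 2) * pderiv 0 (fPoly A B))) • theta0 A B =
        formD (X 0 ^ m * X 1) + ν := by
  have ha := vanishesOn_rule_a A B hD ((m : MvPolynomial (Fin 2) ℂ) * X 0 ^ (m - 1))
  have hb := vanishesOn_rule_b A B hD (X 0 ^ m)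
  refine ⟨-(((![(m : MvPolynomial (Fin 2) ℂ) * X 0 ^ (m - 1) * X 1, 0] : Fin 2 → MvPolynomial (Fin 2) ℂ) -
      ((m : MvPolynomial (Fin 2) ℂ) * X 0 ^ (m - 1) * fPoly A B) • theta0 A B) +
    ((![0, X 0 ^ m] : Fin 2 → MvPolynomial (Fin 2) ℂ) -
      (X 0 ^ m * (C (1 / 2) * pderiv 0 (fPoly A B))) • theta0 A B)),
    (ha.add hb).smul (-1) |> fun h => by simpa using h, ?_⟩
  rw [formD_X_pow_mul_X_one, add_smul]
  have hvec : (![(m : MvPolynomial (Fin 2) ℂ) * X 0 ^ (m - 1) * X 1, X 0 ^ m] :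
      Fin 2 → MvPolynomial (Fin 2) ℂ) =
      (![(m : MvPolynomial (Fin 2) ℂ) * X 0 ^ (m - 1) * X 1, 0] : Fin 2 → MvPolynomial (Fin 2) ℂ) +
        ![0, X 0 ^ m] := by
    funext k
    fin_cases k <;> simp
  rw [hvec]
  abel

/-- **`xᴺ θ₀` is reducible** for every `N` (the classes of `xᴺ dx/y` in `H¹_dR(E)` are combinations
of `dx/y`, `x dx/y`): strong induction along `x^{m+2} θ₀ = (R_m θ₀ − (m + ½)A xᵐ θ₀ − mB x^{m−1} θ₀)/(m + 3/2)`
and `R_m θ₀ ≡ d(xᵐ y)`. [cite: HuberWustholz2022, §13.2 (p. 123)] -/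
theorem ered_X_pow_smul_theta0 (hA : IsAlgebraic ℚ A) (hB : IsAlgebraic ℚ B) (hD : disc A B ≠ 0) :
    ∀ N : ℕ, ERed A B ((X 0 ^ N : MvPolynomial (Fin 2) ℂ) • theta0 A B) := by
  intro N
  induction N using Nat.strong_induction_on with
  | _ N ih =>
    rcases N with _ | N
    · rw [pow_zero, one_smul]
      exact ered_theta0
    rcases N with _ | m
    · rw [zero_add, pow_one]
      exact ered_X_theta0
    -- `N = m + 2`
    have hm1 : m < m + 2 := by omega
    have hm2 : m - 1 < m + 2 := by omega
    have h₁ := ih m hm1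
    have h₂ := ih (m - 1) hm2
    obtain ⟨ν, hv, hR⟩ := rPoly_smul_theta0 A B hD m
    have hc0 : ((m : ℂ) + 3 / 2) ≠ 0 := by
      intro h
      have : ((2 * m + 3 : ℕ) : ℂ) = 0 := by push_cast; linear_combination 2 * h
      exact Nat.cast_ne_zero.2 (by omega) this
    have hc0_alg : IsAlgebraic ℚ ((m : ℂ) + 3 / 2) :=
      (isAlgebraic_nat m).add ((isAlgebraic_nat 3).mul (isAlgebraic_nat 2).inv |> fun h => by
        rw [div_eq_mul_inv]; exact h)
    -- the identity `(m + 3/2) x^{m+2} θ₀ = R_m θ₀ − (m + 1/2)A xᵐ θ₀ − mB x^{m−1} θ₀`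
    have hid : ((m : ℂ) + 3 / 2) • ((X 0 ^ (m + 2) : MvPolynomial (Fin 2) ℂ) • theta0 A B) =
        formD (X 0 ^ m * X 1) + ν - (((m : ℂ) + 1 / 2) * A) • ((X 0 ^ m : MvPolynomial (Fin 2) ℂ) •
          theta0 A B) - ((m : ℂ) * B) • ((X 0 ^ (m - 1) : MvPolynomial (Fin 2) ℂ) • theta0 A B) := by
      rw [← hR, rPoly_eq]
      conv_rhs => rw [add_smul, add_smul, C_mul_smul_theta0, C_mul_smul_theta0, C_mul_smul_theta0]
      abel
    have hνalg : ∀ k, HasAlgCoeffs (ν k) := by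
      have hν : ν = ((m : MvPolynomial (Fin 2) ℂ) * X 0 ^ (m - 1) * fPoly A B +
          X 0 ^ m * (C (1 / 2) * pderiv 0 (fPoly A B))) • theta0 A B - formD (X 0 ^ m * X 1) := by
        rw [hR, add_sub_cancel_left]
      rw [hν]
      intro k
      refine (hasAlgCoeffs_smul_theta0 A B hA hB ?_ k).sub ((((hasAlgCoeffs_X 0).pow m).mul
        (hasAlgCoeffs_X 1)).formD k)
      exact (((hasAlgCoeffs_natCast m).mul ((hasAlgCoeffs_X 0).pow _)).mul
        (hasAlgCoeffs_fPoly A B hA hB)).add (((hasAlgCoeffs_X 0).pow m).mul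
        ((hasAlgCoeffs_C (by rw [one_div]; exact (isAlgebraic_nat 2).inv)).mul
          ((hasAlgCoeffs_fPoly A B hA hB).pderiv 0)))
    have hred : ERed A B (((m : ℂ) + 3 / 2) • ((X 0 ^ (m + 2) : MvPolynomial (Fin 2) ℂ) •
        theta0 A B)) := by
      rw [hid, sub_eq_add_neg, sub_eq_add_neg, ← neg_smul, ← neg_smul]
      exact ered_add (ered_add (ered_add (ered_formD (((hasAlgCoeffs_X 0).pow m).mul
        (hasAlgCoeffs_X 1))) (ered_vanish hνalg hv))
        (ered_smul ((((isAlgebraic_nat m).add (by rw [one_div]; exact (isAlgebraic_nat 2).inv)).mul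
          hA).neg) h₁)) (ered_smul (((isAlgebraic_nat m).mul hB).neg) h₂)
    have h := ered_smul hc0_alg.inv hred
    rwa [smul_smul, inv_mul_cancel₀ hc0, one_smul] at h

/-! ### Univariate polynomials: `p(x) θ₀` is reducible and `p(x) dx` is exact -/

/-- `(Σₙ cₙ xⁿ) θ₀` is reducible. [folklore] -/
theorem ered_sum_smul_theta0 (hA : IsAlgebraic ℚ A) (hB : IsAlgebraic ℚ B) (hD : disc A B ≠ 0)
    (S : Finset ℕ) (c : ℕ → ℂ) (hc : ∀ n ∈ S, IsAlgebraic ℚ (c n)) :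
    ERed A B ((∑ n ∈ S, C (c n) * X 0 ^ n : MvPolynomial (Fin 2) ℂ) • theta0 A B) := by
  rw [Finset.sum_smul]
  refine ered_sum S _ fun n hn => ?_
  rw [C_mul_smul_theta0]
  exact ered_smul (hc n hn) (ered_X_pow_smul_theta0 A B hA hB hD n)

/-- `(Σₙ cₙ xⁿ) dx = d(Σₙ cₙ xⁿ⁺¹/(n+1))` is exact, hence reducible. [folklore] -/
theorem ered_sum_dx (S : Finset ℕ) (c : ℕ → ℂ) (hc : ∀ n ∈ S, IsAlgebraic ℚ (c n)) :
    ERed A B (![∑ n ∈ S, C (c n) * X 0 ^ n, 0] : Fin 2 → MvPolynomial (Fin 2) ℂ) := by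
  classical
  have key : (![∑ n ∈ S, C (c n) * X 0 ^ n, 0] : Fin 2 → MvPolynomial (Fin 2) ℂ) =
      formD (∑ n ∈ S, C (c n / ((n : ℂ) + 1)) * X 0 ^ (n + 1)) := by
    have h0 : ∀ n : ℕ, pderiv 0 (C (c n / ((n : ℂ) + 1)) * X 0 ^ (n + 1)) =
        (C (c n) * X 0 ^ n : MvPolynomial (Fin 2) ℂ) := fun n => by
      have hn1 : ((n : ℂ) + 1) ≠ 0 := by exact_mod_cast Nat.succ_ne_zero n
      rw [pderiv_C_mul, X_pow_eq_monomial, X_pow_eq_monomial, pderiv_monomial, Finsupp.single_eq_same,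
        ← Finsupp.single_tsub, Nat.add_sub_cancel, C_mul_monomial, C_mul_monomial, mul_one]
      congr 1
      push_cast
      field_simp
    have h1 : ∀ n : ℕ, pderiv 1 (C (c n / ((n : ℂ) + 1)) * X 0 ^ (n + 1)) =
        (0 : MvPolynomial (Fin 2) ℂ) := fun n => by
      rw [pderiv_C_mul, X_pow_eq_monomial, pderiv_monomial]
      simp
    funext k
    fin_cases k
    · simp only [formD, map_sum, Fin.zero_eta, Matrix.cons_val_zero]
      exact Finset.sum_congr rfl fun n _ => (h0 n).symm
    · simp only [formD, map_sum, Fin.mk_one, Matrix.cons_val_one, Matrix.cons_val_fin_one]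
      rw [Finset.sum_congr rfl fun n _ => h1 n, Finset.sum_const_zero]
  rw [key]
  refine ered_formD (hasAlgCoeffs_finsetSum _ _ fun n hn => (hasAlgCoeffs_C ?_).mul
    ((hasAlgCoeffs_X 0).pow _))
  rw [div_eq_mul_inv]
  exact (hc n hn).mul (by exact_mod_cast (isAlgebraic_nat (R := ℚ) (A := ℂ) (n + 1)).inv)

/-! ### Univariate polynomials over `ℚ̄` inside `ℂ[x, y]` -/

/-- `p(x) ∈ ℂ[x, y]` for `p ∈ ℂ[X]`, as a sum of monomials. [folklore] -/
theorem eval₂_X_zero_eq_sum (p : Polynomial ℂ) :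
    p.eval₂ (C : ℂ →+* MvPolynomial (Fin 2) ℂ) (X 0) = ∑ n ∈ p.support, C (p.coeff n) * X 0 ^ n := by
  rw [Polynomial.eval₂_eq_sum, Polynomial.sum_def]

/-- [folklore] -/
theorem eval_eval₂_X_zero (p : Polynomial ℂ) (z : Fin 2 → ℂ) :
    eval z (p.eval₂ (C : ℂ →+* MvPolynomial (Fin 2) ℂ) (X 0)) = p.eval (z 0) := by
  rw [eval₂_X_zero_eq_sum, map_sum, Polynomial.eval_eq_sum, Polynomial.sum_def]
  exact Finset.sum_congr rfl fun n _ => by simp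

/-- [folklore] -/
theorem hasAlgCoeffs_eval₂_X_zero {p : Polynomial ℂ} (hp : ∀ n, IsAlgebraic ℚ (p.coeff n)) :
    HasAlgCoeffs (p.eval₂ (C : ℂ →+* MvPolynomial (Fin 2) ℂ) (X 0)) := by
  rw [eval₂_X_zero_eq_sum]
  exact hasAlgCoeffs_finsetSum _ _ fun n _ => (hasAlgCoeffs_C (hp n)).mul ((hasAlgCoeffs_X 0).pow n)

/-- [folklore] -/
theorem algPoly_add {p q : Polynomial ℂ} (hp : ∀ n, IsAlgebraic ℚ (p.coeff n))
    (hq : ∀ n, IsAlgebraic ℚ (q.coeff n)) : ∀ n, IsAlgebraic ℚ ((p + q).coeff n) := fun n => by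
  rw [Polynomial.coeff_add]; exact (hp n).add (hq n)

/-- [folklore] -/
theorem algPoly_mul {p q : Polynomial ℂ} (hp : ∀ n, IsAlgebraic ℚ (p.coeff n))
    (hq : ∀ n, IsAlgebraic ℚ (q.coeff n)) : ∀ n, IsAlgebraic ℚ ((p * q).coeff n) := fun n => by
  rw [Polynomial.coeff_mul]
  exact isAlgebraic_finsetSum _ _ fun x _ => (hp _).mul (hq _)

/-- [folklore] -/
theorem algPoly_C {a : ℂ} (ha : IsAlgebraic ℚ a) : ∀ n, IsAlgebraic ℚ ((Polynomial.C a).coeff n) := by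
  intro n
  rw [Polynomial.coeff_C]
  split_ifs
  · exact ha
  · exact isAlgebraic_zero

/-- [folklore] -/
theorem algPoly_X : ∀ n, IsAlgebraic ℚ ((Polynomial.X : Polynomial ℂ).coeff n) := by
  intro n
  rw [Polynomial.coeff_X]
  split_ifs
  · exact isAlgebraic_one
  · exact isAlgebraic_zero

/-- [folklore] -/
theorem algPoly_pow {p : Polynomial ℂ} (hp : ∀ n, IsAlgebraic ℚ (p.coeff n)) :
    ∀ k n, IsAlgebraic ℚ ((p ^ k).coeff n)
  | 0 => by
    intro n
    rw [pow_zero, Polynomial.coeff_one]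
    split_ifs
    · exact isAlgebraic_one
    · exact isAlgebraic_zero
  | k + 1 => by rw [pow_succ]; exact algPoly_mul (algPoly_pow hp k) hp

/-- [folklore] -/
theorem algPoly_zero : ∀ n, IsAlgebraic ℚ ((0 : Polynomial ℂ).coeff n) := fun n => by
  rw [Polynomial.coeff_zero]; exact isAlgebraic_zero

/-- `f̂ = X³ + AX + B ∈ ℂ[X]` maps to `f`. [folklore] -/
theorem eval₂_fHat : (Polynomial.X ^ 3 + Polynomial.C A * Polynomial.X + Polynomial.C B).eval₂
    (C : ℂ →+* MvPolynomial (Fin 2) ℂ) (X 0) = fPoly A B := by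
  simp [fPoly, Polynomial.eval₂_add, Polynomial.eval₂_mul, Polynomial.eval₂_pow]

/-- `f̂′ = 3X² + A` maps to `∂f/∂x`. [folklore] -/
theorem eval₂_fHat' : (Polynomial.C 3 * Polynomial.X ^ 2 + Polynomial.C A).eval₂
    (C : ℂ →+* MvPolynomial (Fin 2) ℂ) (X 0) = pderiv 0 (fPoly A B) := by
  rw [pderiv_zero_fPoly]
  simp [Polynomial.eval₂_add, Polynomial.eval₂_mul, Polynomial.eval₂_pow]

section HasAlgCoeffs

variable (hA : IsAlgebraic ℚ A) (hB : IsAlgebraic ℚ B)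
include hA hB

/-- [folklore] -/
theorem algPoly_fHat : ∀ n, IsAlgebraic ℚ
    ((Polynomial.X ^ 3 + Polynomial.C A * Polynomial.X + Polynomial.C B : Polynomial ℂ).coeff n) :=
  algPoly_add (algPoly_add (algPoly_pow algPoly_X 3) (algPoly_mul (algPoly_C hA) algPoly_X)) (algPoly_C hB)

omit hB in
/-- [folklore] -/
theorem algPoly_fHat' : ∀ n, IsAlgebraic ℚ
    ((Polynomial.C 3 * Polynomial.X ^ 2 + Polynomial.C A : Polynomial ℂ).coeff n) :=
  algPoly_add (algPoly_mul (algPoly_C (isAlgebraic_nat 3)) (algPoly_pow algPoly_X 2)) (algPoly_C hA)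

/-- `p(x) θ₀` is reducible for `p ∈ ℚ̄[X]`. [folklore] -/
theorem ered_eval₂_smul_theta0 (hD : disc A B ≠ 0) {p : Polynomial ℂ}
    (hp : ∀ n, IsAlgebraic ℚ (p.coeff n)) :
    ERed A B ((p.eval₂ (C : ℂ →+* MvPolynomial (Fin 2) ℂ) (X 0)) • theta0 A B) := by
  rw [eval₂_X_zero_eq_sum]
  exact ered_sum_smul_theta0 A B hA hB hD _ _ fun n _ => hp n

end HasAlgCoeffs

/-- `p(x) dx` is reducible (exact) for `p ∈ ℚ̄[X]`. [folklore] -/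
theorem ered_eval₂_dx {p : Polynomial ℂ} (hp : ∀ n, IsAlgebraic ℚ (p.coeff n)) :
    ERed A B (![p.eval₂ (C : ℂ →+* MvPolynomial (Fin 2) ℂ) (X 0), 0] :
      Fin 2 → MvPolynomial (Fin 2) ℂ) := by
  rw [eval₂_X_zero_eq_sum]
  exact ered_sum_dx A B _ _ fun n _ => hp n

/-! ### Splitting `G(x, y) = g₀(x) + g₁(x) y` on `E_{A,B}` -/

/-- **On `E_{A,B}` every polynomial is `g₀(x) + g₁(x) y`** with `g₀, g₁ ∈ ℚ̄[X]` (`y² = f(x)`).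
[folklore] -/
theorem exists_split (hA : IsAlgebraic ℚ A) (hB : IsAlgebraic ℚ B) (G : MvPolynomial (Fin 2) ℂ)
    (hG : HasAlgCoeffs G) :
    ∃ g₀ g₁ : Polynomial ℂ, (∀ n, IsAlgebraic ℚ (g₀.coeff n)) ∧ (∀ n, IsAlgebraic ℚ (g₁.coeff n)) ∧
      ∀ z ∈ (weierCurve A B).points, eval z G = g₀.eval (z 0) + g₁.eval (z 0) * z 1 := by
  classical
  have hf : ∀ z ∈ (weierCurve A B).points,
      (Polynomial.X ^ 3 + Polynomial.C A * Polynomial.X + Polynomial.C B : Polynomial ℂ).eval (z 0) =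
        z 1 ^ 2 := fun z hz => by
    rw [(mem_points_iff A B z).1 hz, eval_fPoly]
    simp
  have key : ∀ S : Finset (Fin 2 →₀ ℕ), ∃ g₀ g₁ : Polynomial ℂ, (∀ n, IsAlgebraic ℚ (g₀.coeff n)) ∧
      (∀ n, IsAlgebraic ℚ (g₁.coeff n)) ∧ ∀ z ∈ (weierCurve A B).points,
        eval z (∑ d ∈ S, monomial d (coeff d G)) = g₀.eval (z 0) + g₁.eval (z 0) * z 1 := by
    intro S
    induction S using Finset.induction_on with
    | empty => exact ⟨0, 0, algPoly_zero, algPoly_zero, fun z _ => by simp⟩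
    | insert d S hd ih =>
      obtain ⟨g₀, g₁, h₀, h₁, he⟩ := ih
      have hm : ∀ z : Fin 2 → ℂ, eval z (monomial d (coeff d G)) = coeff d G * z 0 ^ d 0 * z 1 ^ d 1 := by
        intro z
        rw [monomial_eq, Finsupp.prod_pow, Fin.prod_univ_two, map_mul, map_mul, map_pow, map_pow, eval_C,
          eval_X, eval_X, mul_assoc]
      rcases Nat.even_or_odd (d 1) with ⟨k, hk⟩ | ⟨k, hk⟩
      · refine ⟨g₀ + Polynomial.C (coeff d G) * Polynomial.X ^ d 0 *
          (Polynomial.X ^ 3 + Polynomial.C A * Polynomial.X + Polynomial.C B) ^ k, g₁,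
          algPoly_add h₀ (algPoly_mul (algPoly_mul (algPoly_C (hG d)) (algPoly_pow algPoly_X _))
            (algPoly_pow (algPoly_fHat A B hA hB) k)), h₁, fun z hz => ?_⟩
        rw [Finset.sum_insert hd, map_add, he z hz, hm z, hk]
        simp only [Polynomial.eval_add, Polynomial.eval_mul, Polynomial.eval_pow, Polynomial.eval_C,
          Polynomial.eval_X, hf z hz]
        ring
      · refine ⟨g₀, g₁ + Polynomial.C (coeff d G) * Polynomial.X ^ d 0 *
          (Polynomial.X ^ 3 + Polynomial.C A * Polynomial.X + Polynomial.C B) ^ k, h₀,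
          algPoly_add h₁ (algPoly_mul (algPoly_mul (algPoly_C (hG d)) (algPoly_pow algPoly_X _))
            (algPoly_pow (algPoly_fHat A B hA hB) k)), fun z hz => ?_⟩
        rw [Finset.sum_insert hd, map_add, he z hz, hm z, hk]
        simp only [Polynomial.eval_add, Polynomial.eval_mul, Polynomial.eval_pow, Polynomial.eval_C,
          Polynomial.eval_X, hf z hz]
        ring
  obtain ⟨g₀, g₁, h₀, h₁, he⟩ := key G.support
  refine ⟨g₀, g₁, h₀, h₁, fun z hz => ?_⟩
  rw [← he z hz, ← as_sum G]

/-! ### The reduction of polynomial 1-forms on `E_{A,B}` -/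

/-- **Reduction of polynomial 1-forms on `E_{A,B}`**: every polynomial 1-form over `ℚ̄` is
`ω = a · θ₀ + b · xθ₀ + dP + ν` with `a, b ∈ ℚ̄`, `P ∈ ℚ̄[x, y]` and `ν` over `ℚ̄` vanishing on the
tangent lines of `E_{A,B}` — the de Rham side of the genus-one period computation: `H¹_dR(E)` of
the affine curve `E = Ē ∖ {O}` is two-dimensional, spanned by the classes of `dx/y` (first kind)
and `x dx/y` (second kind), whose periods along closed paths are `ω₁, ω₂` and the quasi-periods
`η₁, η₂`. Steps: `G = g₀ + g₁ y`, `H = h₀ + h₁ y` on `E` (`exists_split`); `g₀ dx` exact,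
`g₁ y dx ≡ (g₁ f) θ₀` (rule (a)), `h₀ dy ≡ (h₀ f′/2) θ₀` (rule (b)), `h₁ y dy ≡ (h₁ f′/2) dx` exact
(rule (c)); `p(x) θ₀` reducible (`ered_X_pow_smul_theta0`).
[cite: HuberWustholz2022, §13.2 (p. 123)] -/
theorem exists_reduction (hA : IsAlgebraic ℚ A) (hB : IsAlgebraic ℚ B) (hD : disc A B ≠ 0)
    (ω : Fin 2 → MvPolynomial (Fin 2) ℂ) (h : ∀ k, HasAlgCoeffs (ω k)) :
    ∃ (a b : ℂ) (P : MvPolynomial (Fin 2) ℂ) (ν : Fin 2 → MvPolynomial (Fin 2) ℂ),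
      IsAlgebraic ℚ a ∧ IsAlgebraic ℚ b ∧ HasAlgCoeffs P ∧ (∀ k, HasAlgCoeffs (ν k)) ∧
        VanishesOn (weierCurve A B) ν ∧
        ω = a • theta0 A B + b • ((X 0 : MvPolynomial (Fin 2) ℂ) • theta0 A B) + formD P + ν := by
  obtain ⟨g₀, g₁, hg₀, hg₁, hG⟩ := exists_split A B hA hB (ω 0) (h 0)
  obtain ⟨h₀, h₁, hh₀, hh₁, hH⟩ := exists_split A B hA hB (ω 1) (h 1)
  have hfa := algPoly_fHat A B hA hB
  have hfa' := algPoly_fHat' A hA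
  have halg : ∀ {p : Polynomial ℂ}, (∀ n, IsAlgebraic ℚ (p.coeff n)) →
      HasAlgCoeffs (p.eval₂ (C : ℂ →+* MvPolynomial (Fin 2) ℂ) (X 0)) := fun hp =>
    hasAlgCoeffs_eval₂_X_zero hp
  have hhalf : IsAlgebraic ℚ ((1 : ℂ) / 2) := by rw [one_div]; exact (isAlgebraic_nat 2).inv
  have hf'alg : HasAlgCoeffs (C (1 / 2) * pderiv 0 (fPoly A B)) :=
    (hasAlgCoeffs_C hhalf).mul ((hasAlgCoeffs_fPoly A B hA hB).pderiv 0)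
  -- the four model pieces
  have r₁ : ERed A B (![g₀.eval₂ (C : ℂ →+* MvPolynomial (Fin 2) ℂ) (X 0), 0] :
      Fin 2 → MvPolynomial (Fin 2) ℂ) := ered_eval₂_dx A B hg₀
  have r₂ : ERed A B (![g₁.eval₂ (C : ℂ →+* MvPolynomial (Fin 2) ℂ) (X 0) * X 1, 0] :
      Fin 2 → MvPolynomial (Fin 2) ℂ) := by
    refine ered_congr (fun k => ?_) (hasAlgCoeffs_smul_theta0 A B hA hB
      ((halg hg₁).mul (hasAlgCoeffs_fPoly A B hA hB))) (vanishesOn_rule_a A B hD _) ?_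
    · fin_cases k
      · simpa using (halg hg₁).mul (hasAlgCoeffs_X 1)
      · simpa using (hasAlgCoeffs_zero (n := 2))
    · have he : g₁.eval₂ (C : ℂ →+* MvPolynomial (Fin 2) ℂ) (X 0) * fPoly A B =
          (g₁ * (Polynomial.X ^ 3 + Polynomial.C A * Polynomial.X + Polynomial.C B)).eval₂ C (X 0) := by
        rw [Polynomial.eval₂_mul, eval₂_fHat]
      rw [he]
      exact ered_eval₂_smul_theta0 A B hA hB hD (algPoly_mul hg₁ hfa)
  have r₃ : ERed A B (![0, h₀.eval₂ (C : ℂ →+* MvPolynomial (Fin 2) ℂ) (X 0)] :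
      Fin 2 → MvPolynomial (Fin 2) ℂ) := by
    refine ered_congr (fun k => ?_) (hasAlgCoeffs_smul_theta0 A B hA hB ((halg hh₀).mul hf'alg))
      (vanishesOn_rule_b A B hD _) ?_
    · fin_cases k
      · simpa using (hasAlgCoeffs_zero (n := 2))
      · simpa using halg hh₀
    · have he : h₀.eval₂ (C : ℂ →+* MvPolynomial (Fin 2) ℂ) (X 0) * (C (1 / 2) * pderiv 0 (fPoly A B)) =
          (h₀ * (Polynomial.C (1 / 2) * (Polynomial.C 3 * Polynomial.X ^ 2 + Polynomial.C A))).eval₂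
            C (X 0) := by
        rw [Polynomial.eval₂_mul, Polynomial.eval₂_mul, Polynomial.eval₂_C, eval₂_fHat']
      rw [he]
      exact ered_eval₂_smul_theta0 A B hA hB hD (algPoly_mul hh₀ (algPoly_mul (algPoly_C hhalf) hfa'))
  have r₄ : ERed A B (![0, h₁.eval₂ (C : ℂ →+* MvPolynomial (Fin 2) ℂ) (X 0) * X 1] :
      Fin 2 → MvPolynomial (Fin 2) ℂ) := by
    refine ered_congr (fun k => ?_) (fun k => ?_) (vanishesOn_rule_c A B _) ?_
    · fin_cases k
      · simpa using (hasAlgCoeffs_zero (n := 2))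
      · simpa using (halg hh₁).mul (hasAlgCoeffs_X 1)
    · fin_cases k
      · simpa using (halg hh₁).mul hf'alg
      · simpa using (hasAlgCoeffs_zero (n := 2))
    · have he : (![h₁.eval₂ (C : ℂ →+* MvPolynomial (Fin 2) ℂ) (X 0) * (C (1 / 2) * pderiv 0 (fPoly A B)),
          0] : Fin 2 → MvPolynomial (Fin 2) ℂ) =
          ![(h₁ * (Polynomial.C (1 / 2) * (Polynomial.C 3 * Polynomial.X ^ 2 + Polynomial.C A))).eval₂
            C (X 0), 0] := by
        rw [Polynomial.eval₂_mul, Polynomial.eval₂_mul, Polynomial.eval₂_C, eval₂_fHat']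
      rw [he]
      exact ered_eval₂_dx A B (algPoly_mul hh₁ (algPoly_mul (algPoly_C hhalf) hfa'))
  -- `ω` agrees with the sum of the pieces on `E_{A,B}`
  have hsum := ered_add (ered_add (ered_add r₁ r₂) r₃) r₄
  refine ered_congr h (fun k => ?_) (vanishesOn_of_eval_eq_zero _ fun z hz k => ?_) hsum
  · fin_cases k
    · simpa using ((halg hg₀).add ((halg hg₁).mul (hasAlgCoeffs_X 1)))
    · simpa using ((halg hh₀).add ((halg hh₁).mul (hasAlgCoeffs_X 1)))
  · fin_cases k
    · simp [eval_eval₂_X_zero, hG z hz]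
    · simp [eval_eval₂_X_zero, hH z hz]

/-! ### Symbols on `E_{A,B}` -/

/-- **Every symbol on `E_{A,B}` is `a · (E, θ₀, γ) + b · (E, xθ₀, γ) + e · 𝟙` modulo the elementary
relations**, with `a, b, e ∈ ℚ̄` ((R1), (R2), (R3); `exists_reduction`): its period is
`a ∫_γ dx/y + b ∫_γ x dx/y + e`, an algebraic combination of an (in)complete elliptic integral of
the first kind, one of the second kind and `1`. [cite: HuberWustholz2022, §13.2 (p. 123)] -/
theorem exists_rel_symbol (hA : IsAlgebraic ℚ A) (hB : IsAlgebraic ℚ B) (hD : disc A B ≠ 0)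
    (ω : Fin 2 → MvPolynomial (Fin 2) ℂ) (h : ∀ k, HasAlgCoeffs (ω k)) (γ : CurvePath (weierCurve A B)) :
    ∃ a b e : ℂ, IsAlgebraic ℚ a ∧ IsAlgebraic ℚ b ∧ IsAlgebraic ℚ e ∧
      InSpan (Finsupp.single (⟨weierCurve A B, isSmoothAffineCurve A B hA hB hD, ω, h, γ⟩ : PeriodSymbol)
          (1 : ℂ) -
        a • Finsupp.single (⟨weierCurve A B, isSmoothAffineCurve A B hA hB hD, theta0 A B,
          hasAlgCoeffs_theta0 A B hA hB, γ⟩ : PeriodSymbol) (1 : ℂ) -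
        b • Finsupp.single (⟨weierCurve A B, isSmoothAffineCurve A B hA hB hD,
          (X 0 : MvPolynomial (Fin 2) ℂ) • theta0 A B,
          hasAlgCoeffs_smul_theta0 A B hA hB (hasAlgCoeffs_X 0), γ⟩ : PeriodSymbol) (1 : ℂ) -
        e • Finsupp.single PeriodSymbol.unit (1 : ℂ)) := by
  have hE := isSmoothAffineCurve A B hA hB hD
  obtain ⟨a, b, P, ν, ha, hb, hP, hν, hv, he⟩ := exists_reduction A B hA hB hD ω h
  have hθ := hasAlgCoeffs_theta0 A B hA hB
  have hxθ := hasAlgCoeffs_smul_theta0 A B hA hB (hasAlgCoeffs_X 0)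
  have haθ : ∀ k, HasAlgCoeffs ((a • theta0 A B) k) := fun k => (hθ k).smul ha
  have hbθ : ∀ k, HasAlgCoeffs ((b • ((X 0 : MvPolynomial (Fin 2) ℂ) • theta0 A B)) k) :=
    fun k => (hxθ k).smul hb
  have h₁ : ∀ k, HasAlgCoeffs ((a • theta0 A B + b • ((X 0 : MvPolynomial (Fin 2) ℂ) • theta0 A B)) k) :=
    fun k => (haθ k).add (hbθ k)
  have hdP : ∀ k, HasAlgCoeffs (formD P k) := hP.formD
  have h₂ : ∀ k, HasAlgCoeffs ((a • theta0 A B + b • ((X 0 : MvPolynomial (Fin 2) ℂ) • theta0 A B) +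
      formD P) k) := fun k => (h₁ k).add (hdP k)
  have r₁ := IsElementaryRelation.add _ hE γ ω _ ν h h₂ hν he
  have r₂ := IsElementaryRelation.vanish _ hE γ ν hν hv
  have r₃ := IsElementaryRelation.add _ hE γ _ _ _ h₂ h₁ hdP rfl
  have r₄ := IsElementaryRelation.exact _ hE γ P hP _ hdP rfl
  have r₅ := IsElementaryRelation.add _ hE γ _ _ _ h₁ haθ hbθ rfl
  have r₆ := IsElementaryRelation.smul _ hE γ a ha (theta0 A B) _ hθ haθ rfl
  have r₇ := IsElementaryRelation.smul _ hE γ b hb ((X 0 : MvPolynomial (Fin 2) ℂ) • theta0 A B) _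
    hxθ hbθ rfl
  refine ⟨a, b, eval (γ.toFun 1) P - eval (γ.toFun 0) P, ha, hb,
    (hP.isAlgebraic_eval γ.algebraic_one).sub (hP.isAlgebraic_eval γ.algebraic_zero), ?_⟩
  obtain ⟨k, ρ, c, hρ, hc, hsum⟩ := span_add (span_add (span_add (span_add (span_add (span_add
    (span_of_rel r₁) (span_of_rel r₂)) (span_of_rel r₃)) (span_of_rel r₄)) (span_of_rel r₅))
    (span_of_rel r₆)) (span_of_rel r₇)
  refine ⟨k, ρ, c, hρ, hc, ?_⟩
  rw [← hsum]
  abel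

end Weier

end CurvePeriods

end Literature.NumberTheory.Transcendental

end
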